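import Literature.Algebra.EuclideanLattices.RegevUSVPInput
import Literature.Algebra.EuclideanLattices.GapInstanceCodeFP
import Literature.Computability.Complexity.CodeFPBudgets
import HarnessLib

/-!
# Regev's reduction `uSVP ≤ DCP`: the pre-processor is polynomial time

Seventeenth file (XIV-d) of the construction discharging `usvp_of_dihedralCoset` (Regev 2004,
Thm. 1.1): **the input `xOf f I` of the per-copy routine (file XIV-c) is computed from the code of
the instance in polynomial time** (`xOf_codeFP`, in the typed algebra `CodeFP`): read `n` and the
rows, scale the rows by `2ⁿ`, write the payload `(rows, p, Q, radii)` in the code of file IX, and pad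
to the length `L = s² + n`. (The LLL step in front of it is `RegevUniqueSVP.lean`.)

## References

* O. Regev, *Quantum computation and lattice problems*, SIAM J. Comput. 33 (2004), proof of
  Lemma 3.12 (p. 14) and of Thm. 1.1 (p. 7).
* S. Arora, B. Barak, *Computational Complexity: A Modern Approach*, CUP 2009, §1.3.
-/

noncomputable section

namespace Literature.Algebra.EuclideanLattices

namespace RegevRoutine

open _root_.Computability Literature.Computability.Complexity Literature.Computability.Complexity.CodeFP
  Literature.Computability.Complexity.LMat Regev2004 Polynomial

/-! ### Reading the instance -/

/-- The code of an instance, as a string. [folklore] -/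
theorem instSelf : CodeFP LatticeInstance.encode strE LatticeInstance.encode := ⟨id, PolyTimeComputable.id _, fun _ => rfl⟩

/-- The dimension, in binary. [cite: MicciancioGoldwasser2002, Ch. 1 §1.2] -/
theorem instN : CodeFP LatticeInstance.encode natE (fun I => I.n) :=
  ⟨Brick.fstF, Brick.fstF_mem_FP, fun I => by rw [LLLMachine.encode_eq_record]; exact Brick.fstF_boolPair _ _⟩

/-- `n ≤ |code|`. [folklore] -/
theorem n_le_length_encode (I : LatticeInstance) : I.n ≤ I.encode.length := by
  rw [LLLMachine.encode_eq_record, length_boolPair, length_boolPair]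
  have h1 : (unaryEncodeNat (I.n * I.n)).length = I.n * I.n := CodeFP.length_unE _
  rw [h1]
  nlinarith

/-- The dimension, in unary. [folklore] -/
theorem instNUn : CodeFP LatticeInstance.encode unE (fun I => I.n) := by
  have h := (unOfNatMin.comp ((strLength.comp instSelf).pair instN) :)
  exact h.congr fun I => min_eq_left (n_le_length_encode I)

/-- The row-major entries. [folklore] -/
theorem instFlat : CodeFP LatticeInstance.encode (rawE intE) (fun I => rowMajor I.n (GapCodes.matRows I.basis)) := by
  have hsnd : CodeFP LatticeInstance.encode (listE smE) (fun I => rowMajor I.n (GapCodes.matRows I.basis)) := by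
    refine ⟨Brick.sndF, Brick.sndF_mem_FP, fun I => ?_⟩
    obtain ⟨n, B⟩ := I
    have e : (⟨n, B⟩ : LatticeInstance) = ⟨n, toMat n n (GapCodes.matRows B)⟩ := by rw [GapCodes.toMat_matRows]
    rw [e, latticeInstance_encode_toMat, Brick.sndF_boolPair]
    change listE smE (rowMajor n (GapCodes.matRows B)) = listE smE (rowMajor n (GapCodes.matRows (toMat n n (GapCodes.matRows B))))
    rw [GapCodes.toMat_matRows]
  have h := ((map₀ intOfSM).comp ((rawOfList smE).comp hsnd) :)
  exact h.congr fun _ => by simp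

/-- **The rows of the basis.** [folklore] -/
theorem instRows : CodeFP LatticeInstance.encode matE rowsOf := by
  have h := (GapCodes.rowsOfFlat_codeFP.comp (instNUn.pair instFlat) :)
  exact h.congr fun I => by
    change GapCodes.rowsOfFlat I.n (rowMajor I.n (GapCodes.matRows I.basis)) = rowsOf I
    rw [GapCodes.rowsOfFlat_rowMajor_matRows]; rfl

/-! ### The payload -/

/-- Scaling the rows by a scalar. [folklore] -/
theorem scaleRowsFP : CodeFP (pairE intE matE) matE (fun p => p.2.map fun row => row.map fun a => p.1 * a) := by
  have h := (map (map intMul) :)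
  exact h.congr fun _ => rfl

/-- The rows of the scaled instance. [folklore] -/
theorem rowsOf_Jof (I : LatticeInstance) : rowsOf (Jof I) = (rowsOf I).map fun row => row.map fun a => scaleOf I.n * a := by
  unfold rowsOf
  rw [List.map_ofFn]
  congr 1
  funext i
  rw [Function.comp_apply, List.map_ofFn]
  congr 1

/-- **The rows of `2ⁿ B`.** [folklore] -/
theorem instRowsJ : CodeFP LatticeInstance.encode matE (fun I => rowsOf (Jof I)) := by
  have h := (scaleRowsFP.comp ((intPow.comp ((const _ (2 : ℤ)).pair instNUn)).pair instRows) :)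
  exact h.congr fun I => by rw [rowsOf_Jof]; rfl

/-- The bit size of a number, in unary. [folklore] -/
theorem sizeUn : CodeFP natE unE Nat.size := by
  have h := (strLength.comp strOfNat :)
  exact h.congr fun n => CodeFP.length_natE n

/-- A power of `n` with a constant exponent. [folklore] -/
theorem instNPow (e : ℕ) : CodeFP LatticeInstance.encode natE (fun I => I.n ^ e) := by
  have h := (natPow.comp (instN.pair (const _ e)) :)
  exact h.congr fun _ => rfl

/-- **The modulus `p`.** [folklore] -/
theorem instP (f : ℝ) : CodeFP LatticeInstance.encode natE (fun I => pOf f I.n) := by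
  have h := (natPow.comp ((const _ 2).pair (sizeUn.comp (natAdd.comp ((natMul.comp ((const _ (2 * cA f)).pair (instNPow (2 * kOf f + 1)))).pair
    (const _ 2))))) :)
  exact h.congr fun _ => rfl

/-- **The level count `Q`.** [folklore] -/
theorem instQ (f : ℝ) : CodeFP LatticeInstance.encode natE (fun I => Qof f I.n) := by
  have h := (natAdd.comp ((natMul.comp ((const _ (128 * 5 ^ kOf f)).pair (instNPow (2 * kOf f + 2)))).pair
    (natMul.comp ((const _ 2).pair instN))) :)
  exact h.congr fun _ => rfl

/-- **The table length `T`.** [folklore] -/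
theorem instT (f : ℝ) : CodeFP LatticeInstance.encode natE (fun I => Tof f I) := by
  have h := (natAdd.comp ((natAdd.comp ((natMul.comp ((const _ 2).pair (strNatLength.comp instSelf))).pair
    (natMul.comp ((const _ (4 * kOf f + 8)).pair (natAdd.comp (instN.pair (const _ 1))))))).pair (const _ (2 * cA f))) :)
  exact h.congr fun _ => rfl

/-- The polynomial cap of `T`. [folklore] -/
def TPoly (f : ℝ) : Polynomial ℕ := C 2 * X + C (4 * kOf f + 8) * (X + 1) + C (2 * cA f)

/-- `T ≤ TPoly(|code|)`. [folklore] -/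
theorem Tof_le_TPoly (f : ℝ) (I : LatticeInstance) : Tof f I ≤ (TPoly f).eval I.encode.length := by
  have := n_le_length_encode I
  simp only [TPoly, eval_add, eval_mul, eval_C, eval_X, eval_one]
  unfold Tof; nlinarith

/-- A unary ruler of polynomial length. [folklore] -/
theorem ruler (G : Polynomial ℕ) : CodeFP LatticeInstance.encode unE (fun I => G.eval I.encode.length) :=
  ⟨Plumb.polyFn G, Plumb.polyFn_mem_FP G, fun I => by rw [Plumb.polyFn_apply, unE_eq_ones]⟩

/-- `T` in unary. [folklore] -/
theorem instTUn (f : ℝ) : CodeFP LatticeInstance.encode unE (fun I => Tof f I) := by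
  have h := (unOfNatMin.comp ((ruler (TPoly f)).pair (instT f)) :)
  exact h.congr fun I => min_eq_left (Tof_le_TPoly f I)

/-- **The radius table.** [folklore] -/
theorem instRadii (f : ℝ) : CodeFP LatticeInstance.encode (rawE natE) (fun I => radiiOf f I) := by
  -- item: `2^{min ρ |u|}` in the context of the ruler `u`
  have hitem := (natPow.comp ((const (pairE unE natE) 2).pair unOfNatMin) :)
  have h := ((map hitem).comp ((ruler (TPoly f)).pair (urange.comp (instTUn f))) :)
  refine h.congr fun I => ?_
  change (List.range (Tof f I)).map (fun ρ => 2 ^ min ρ ((TPoly f).eval I.encode.length)) = radiiOf f I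
  unfold radiiOf
  refine List.map_congr_left fun ρ hρ => ?_
  rw [min_eq_left ((List.mem_range.1 hρ).le.trans (Tof_le_TPoly f I))]

/-- The code of payloads, unfolded. [folklore] -/
theorem ePayload_encode_eq_pairE (pl : Payload) :
    ePayload.encode pl = pairE (listE (listE smE)) (pairE natE (pairE natE (listE natE))) pl := by
  obtain ⟨rows, p, Q, radii⟩ := pl
  change boolPair (encodingIntBool.listBool.listBool.encode rows) (boolPair (encodeNat p) (boolPair (encodeNat Q) (encodingNatBool.listBool.encode radii))) = _
  rw [listE_eq, listE_eq, listE_eq]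
  rfl

/-- Rows as headed lists. [folklore] -/
theorem rowsCode : CodeFP matE (listE (listE smE)) id := by
  have h := ((listOfRaw _).comp (map₀ ((listOfRaw smE).comp (map₀ smOfInt))) :)
  exact h.congr fun _ => by simp

/-- The code of the payload of an instance, unfolded. [folklore] -/
theorem codeOf_eq (f : ℝ) (I : LatticeInstance) :
    codeOf f I = pairE (listE (listE smE)) (pairE natE (pairE natE (listE natE))) (rowsOf (Jof I), (pOf f I.n, (Qof f I.n, radiiOf f I))) := by
  rw [codeOf, ePayload_encode_eq_pairE]; rfl

/-- **The code of the payload.** [folklore] -/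
theorem instCode (f : ℝ) : CodeFP LatticeInstance.encode strE (fun I => codeOf f I) := by
  have h := ((rowsCode.comp instRowsJ).pair ((instP f).pair ((instQ f).pair ((listOfRaw natE).comp (instRadii f)))) :)
  refine h.recodeOut fun I => ?_
  rw [codeOf_eq]
  rfl

/-! ### The padding -/

/-- `s`, in binary. [folklore] -/
theorem instS (f : ℝ) : CodeFP LatticeInstance.encode natE (fun I => sOf f I) := by
  have h1 := (natAdd.comp ((natMul.comp ((const _ 2).pair (strNatLength.comp (instCode f)))).pair (const _ 2)) :)
  have h2 := (natAdd.comp (h1.pair instN) :)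
  have h3 := (natAdd.comp (h2.pair (instQ f)) :)
  have h4 := (natAdd.comp (h3.pair (instP f)) :)
  have h5 := (natAdd.comp (h4.pair (instT f)) :)
  exact h5.congr fun _ => rfl

/-- `L`, in binary. [folklore] -/
theorem instL (f : ℝ) : CodeFP LatticeInstance.encode natE (fun I => LOf f I) := by
  have h := (natAdd.comp ((natPow.comp ((instS f).pair (const _ (2 : ℕ)))).pair instN) :)
  exact h.congr fun _ => rfl

/-- The padding length, in binary. [folklore] -/
theorem instPadLen (f : ℝ) : CodeFP LatticeInstance.encode natE (fun I => LOf f I - (2 * (codeOf f I).length + 2)) := by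
  have h := (natSub.comp ((instL f).pair (natAdd.comp ((natMul.comp ((const _ 2).pair (strNatLength.comp (instCode f)))).pair (const _ 2)))) :)
  exact h.congr fun _ => rfl

/-- **`L` is polynomially bounded in the code length.** [folklore] -/
theorem exists_poly_LOf_le (f : ℝ) : ∃ G : Polynomial ℕ, ∀ I : LatticeInstance, LOf f I ≤ G.eval I.encode.length := by
  obtain ⟨F, hF, hFc⟩ := instCode f
  obtain ⟨Pc, hPc⟩ := exists_poly_length_le_of_mem_FP hF
  refine ⟨(C 2 * Pc + C 2 + X + (C (128 * 5 ^ kOf f) * X ^ (2 * kOf f + 2) + C 2 * X) + (C 2 * (C (2 * cA f) * X ^ (2 * kOf f + 1) + C 2) + C 1) +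
    TPoly f) ^ 2 + X, fun I => ?_⟩
  have hn := n_le_length_encode I
  have hc : (codeOf f I).length ≤ Pc.eval I.encode.length := by have h := hPc I.encode; rw [hFc] at h; exact h
  have hT := Tof_le_TPoly f I
  have hp := pOf_le f I.n
  have hQ : Qof f I.n ≤ 128 * 5 ^ kOf f * I.encode.length ^ (2 * kOf f + 2) + 2 * I.encode.length := by
    unfold Qof; gcongr
  have hp' : pOf f I.n ≤ 2 * (2 * cA f * I.encode.length ^ (2 * kOf f + 1) + 2) + 1 :=
    hp.trans (by gcongr)
  have hs : sOf f I ≤ 2 * Pc.eval I.encode.length + 2 + I.encode.length + (128 * 5 ^ kOf f * I.encode.length ^ (2 * kOf f + 2) + 2 * I.encode.length) +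
      (2 * (2 * cA f * I.encode.length ^ (2 * kOf f + 1) + 2) + 1) + (TPoly f).eval I.encode.length := by
    unfold sOf; omega
  have hs2 := Nat.pow_le_pow_left hs 2
  simp only [eval_add, eval_pow, eval_mul, eval_C, eval_X]
  unfold LOf
  omega

/-- **The padding**, in unary, then as a string of ones. [folklore] -/
theorem instPad (f : ℝ) : CodeFP LatticeInstance.encode strE (fun I => padOf f I) := by
  obtain ⟨G, hG⟩ := exists_poly_LOf_le f
  have hu' := (unOfNatMin.comp ((ruler G).pair (instPadLen f)) :)
  have hu : CodeFP LatticeInstance.encode unE (fun I => LOf f I - (2 * (codeOf f I).length + 2)) :=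
    hu'.congr fun I => min_eq_left ((Nat.sub_le _ _).trans (hG I))
  have h := (strOfUn.comp hu :)
  exact h.recodeOut fun I => by rw [padOf, unE_eq_ones]

/-- **The input of the per-copy routine is computed from the code of the instance in polynomial
time.** [cite: Regev2004, Thm. 1.1 (proof, p. 7: the algorithm is efficient) with AroraBarak2009, §1.3] -/
theorem xOf_codeFP (f : ℝ) : CodeFP LatticeInstance.encode strE (fun I => xOf f I) := by
  have h := ((instCode f).pair (instPad f) :)
  exact h.recodeOut fun _ => rfl

/-- **The pre-processor as an `FP` string function**: some `h ∈ FP` maps the code of every instance to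
the routine's input. [folklore] -/
theorem exists_hPre (f : ℝ) : ∃ h ∈ FP, ∀ I : LatticeInstance, h I.encode = xOf f I := xOf_codeFP f

end RegevRoutine

end Literature.Algebra.EuclideanLattices

end
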